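import Mathlib
import Summits.Ventures.HodgeRepro2.T5RecordUnramifiedEveryCMField

/-!
# THE RECORD'S LOCAL DATA OUTSIDE THE ABSOLUTE DISCRIMINANT `disc K`, FOR EVERY CM FIELD — NO DATUM

Tier-5 support N3 / §G-N4.2 (seat p3, gen 83). Files 315–321 describe the exceptional set of the record's local data
through the datum `(d, x)` of file 235 (`{v ∣ 4d}`) and the discriminant of `K⁺`. The tower identity of file 320
removes the datum: a prime `w` of `K` dividing the relative different `𝔇_{K/K⁺}` divides the absolute different
`𝔇_{K/ℚ}`, hence contains `disc K` (Mathlib's `discr_mem_differentIdeal`), hence its contraction `v` contains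
`disc K`. So at EVERY place `v` of `K⁺` not containing the ONE integer `disc K`:

* **`not_dvd_differentIdeal_of_discr_notMem`** — every prime `w ∣ v` is prime to `𝔇_{K/K⁺}`;
  **`not_dvd_differentIdeal_int_of_discr_notMem'`** / **`ramificationIdx_int_eq_one_of_discr_notMem'`** — and to
  `𝔇_{K/ℚ}`, with `e(w/p) = 1`; **`ramificationIdx_int_eq_one_plus_of_discr_notMem`** — `e(v/p) = 1` (the kernel
  half of clause (u2); `disc K⁺ ∣ disc K`, Mathlib's `discr_dvd_discr`);
* **`recordCommutative_of_discr_notMem`** — `H(U(1 ⊗ H), K_v)` is commutative (every hermitian `H` with unit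
  determinant good above `v`); **`map_eq_of_discr_notMem_of_ncard_eq_one`** — `v` stays prime in `K` when one prime
  lies above it; **`recordPolynomial_of_discr_notMem`** / **`chainNumerals_of_discr_notMem`** — `k[X]` and the
  Satake chain with numerals `q = p^{f(v/p)}` there;
* **`finite_setOf_intCast_mem`** — the places containing a non-zero integer form a finite set;
* **`record_hecke_outside_discriminant`** — THE CONSUMER STATEMENT, datum-free: for every CM field `K` and every
  integral unimodular hermitian `H`, the places of `K⁺` containing `disc K` are finitely many, and at every other
  place all of the above holds; **`record_hecke_outside_discriminant_prime`** — the same at every place above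
  every rational prime `p ∤ disc K` (MVW's form, with `2θ` replaced by the discriminant).

§8(d): uses an L-value-free non-vanishing device: NO.
-/

open Matrix NumberField NumberField.IsCMField IsDedekindDomain IsDedekindDomain.HeightOneSpectrum Module Polynomial
  Ideal
open scoped TensorProduct Pointwise
open Summit.Ventures.HodgeRepro2.T5UnitaryGroupForm Summit.Ventures.HodgeRepro2.T5UnitaryHeckeAdjoint
  Summit.Ventures.HodgeRepro2.T5HeckePermutationModule Summit.Ventures.HodgeRepro2.T5HeckeDoubleCoset
  Summit.Ventures.HodgeRepro2.T5RecordHyperspecial Summit.Ventures.HodgeRepro2.T5GlobalLatticeAlmostAll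
  Summit.Ventures.HodgeRepro2.T5FinitePlaceSplitClassification Summit.Ventures.HodgeRepro2.T5RecordSatakeIntrinsic
  Summit.Ventures.HodgeRepro2.T5SplitPlaceUnitaryGroup Summit.Ventures.HodgeRepro2.T5NonSplitPlaceUnitaryGroup
  Summit.Ventures.HodgeRepro2.T5FinitePlaceCM Summit.Ventures.HodgeRepro2.T5StarOfInvolution
  Summit.Ventures.HodgeRepro2.T5CyclotomicSubfieldHeckeCommutative
  Summit.Ventures.HodgeRepro2.T5IntegralGramBadSet Summit.Ventures.HodgeRepro2.T5RecordSatakeDifferent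
  Summit.Ventures.HodgeRepro2.T5CMFieldSquareDatum Summit.Ventures.HodgeRepro2.T5RecordSatakeDifferentDatum
  Summit.Ventures.HodgeRepro2.T5RecordSatakeDifferentSummary Summit.Ventures.HodgeRepro2.T5RecordSatakeDifferentChain
  Summit.Ventures.HodgeRepro2.T5CyclotomicTwentyOneSatake Summit.Ventures.HodgeRepro2.T5CyclotomicSevenHeckeCommutative
  Summit.Ventures.HodgeRepro2.T5RecordDifferentTower Summit.Ventures.HodgeRepro2.T5RecordUnramifiedEveryCMField

namespace Summit.Ventures.HodgeRepro2.T5RecordSatakeDiscriminant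

section Different

variable (K : Type*) [Field K] [NumberField K]

/-- **The relative different divides the absolute one** (the tower identity of file 320). -/
theorem differentIdeal_dvd_differentIdeal_int :
    differentIdeal (𝓞 (maximalRealSubfield K)) (𝓞 K) ∣ differentIdeal ℤ (𝓞 K) :=
  ⟨_, T5RecordDifferentTower.differentIdeal_int_eq_mul_map K⟩

/-- **A prime `w` of `K` dividing `𝔇_{K/K⁺}` contains `disc K`.** -/
theorem discr_mem_of_dvd_differentIdeal (w : HeightOneSpectrum (𝓞 K))
    (hw : w.asIdeal ∣ differentIdeal (𝓞 (maximalRealSubfield K)) (𝓞 K)) :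
    ((discr K : ℤ) : 𝓞 K) ∈ w.asIdeal :=
  T5RecordDifferentTower.discr_mem_of_dvd_differentIdeal_int K w
    (hw.trans (differentIdeal_dvd_differentIdeal_int K))

/-- **… and so does its contraction to `K⁺`.** -/
theorem discr_mem_under_of_dvd_differentIdeal (w : HeightOneSpectrum (𝓞 K))
    (hw : w.asIdeal ∣ differentIdeal (𝓞 (maximalRealSubfield K)) (𝓞 K)) :
    ((discr K : ℤ) : 𝓞 (maximalRealSubfield K)) ∈ w.asIdeal.under (𝓞 (maximalRealSubfield K)) := by
  rw [Ideal.under, Ideal.mem_comap, map_intCast]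
  exact discr_mem_of_dvd_differentIdeal K w hw

variable (v : HeightOneSpectrum (𝓞 (maximalRealSubfield K)))

/-- **`w ∤ 𝔇_{K/K⁺}` for every prime `w` of `K` above a place `v` of `K⁺` not containing `disc K`.** -/
theorem not_dvd_differentIdeal_of_discr_notMem (w : HeightOneSpectrum (𝓞 K)) [hw : w.asIdeal.LiesOver v.asIdeal]
    (hv : ((discr K : ℤ) : 𝓞 (maximalRealSubfield K)) ∉ v.asIdeal) :
    ¬ w.asIdeal ∣ differentIdeal (𝓞 (maximalRealSubfield K)) (𝓞 K) := by
  intro hdvd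
  apply hv
  rw [hw.over]
  exact discr_mem_under_of_dvd_differentIdeal K w hdvd

/-- **`v ∤ 𝔇_{K⁺/ℚ}` when `disc K ∉ v`** (`disc K⁺ ∣ disc K`, Mathlib's `discr_dvd_discr`). -/
theorem not_dvd_differentIdeal_int_plus_of_discr_notMem
    (hv : ((discr K : ℤ) : 𝓞 (maximalRealSubfield K)) ∉ v.asIdeal) :
    ¬ v.asIdeal ∣ differentIdeal ℤ (𝓞 (maximalRealSubfield K)) := by
  refine T5RecordDifferentTower.not_dvd_differentIdeal_int_of_discr_notMem (maximalRealSubfield K) v fun h => hv ?_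
  obtain ⟨c, hc⟩ := discr_dvd_discr (maximalRealSubfield K) K
  rw [hc, Int.cast_mul]
  exact Ideal.mul_mem_right _ _ h

/-- **`e(v/p) = 1` when `disc K ∉ v`** — the kernel half of clause (u2), with the absolute discriminant. -/
theorem ramificationIdx_int_eq_one_plus_of_discr_notMem
    (hv : ((discr K : ℤ) : 𝓞 (maximalRealSubfield K)) ∉ v.asIdeal) :
    v.asIdeal.ramificationIdx ℤ = 1 :=
  T5RecordDifferentTower.ramificationIdx_int_eq_one_of_not_dvd (maximalRealSubfield K) v
    (not_dvd_differentIdeal_int_plus_of_discr_notMem K v hv)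

/-- **`w ∤ 𝔇_{K/ℚ}` for every prime `w` above such a `v`.** -/
theorem not_dvd_differentIdeal_int_of_discr_notMem' (w : HeightOneSpectrum (𝓞 K)) [w.asIdeal.LiesOver v.asIdeal]
    (hv : ((discr K : ℤ) : 𝓞 (maximalRealSubfield K)) ∉ v.asIdeal) :
    ¬ w.asIdeal ∣ differentIdeal ℤ (𝓞 K) :=
  T5RecordDifferentTower.not_dvd_differentIdeal_int_of K w (not_dvd_differentIdeal_of_discr_notMem K v w hv)
    (by rw [← ‹w.asIdeal.LiesOver v.asIdeal›.over]; exact not_dvd_differentIdeal_int_plus_of_discr_notMem K v hv)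

/-- **`e(w/p) = 1` for every prime `w` above such a `v`.** -/
theorem ramificationIdx_int_eq_one_of_discr_notMem' (w : HeightOneSpectrum (𝓞 K)) [w.asIdeal.LiesOver v.asIdeal]
    (hv : ((discr K : ℤ) : 𝓞 (maximalRealSubfield K)) ∉ v.asIdeal) :
    w.asIdeal.ramificationIdx ℤ = 1 :=
  T5RecordDifferentTower.ramificationIdx_int_eq_one_of_not_dvd K w
    (not_dvd_differentIdeal_int_of_discr_notMem' K v w hv)

end Different

section Finite

variable (F : Type*) [Field F] [NumberField F]

/-- **The places of a number field containing a non-zero integer form a finite set** (Mathlib's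
`Ideal.finite_factors` on the principal ideal). -/
theorem finite_setOf_intCast_mem (n : ℤ) (hn : n ≠ 0) :
    {v : HeightOneSpectrum (𝓞 F) | (n : 𝓞 F) ∈ v.asIdeal}.Finite := by
  have hne : span {(n : 𝓞 F)} ≠ 0 := by
    rw [Submodule.zero_eq_bot, ne_eq, span_singleton_eq_bot]
    exact_mod_cast hn
  refine (Ideal.finite_factors hne).subset fun v hv => ?_
  rw [Set.mem_setOf_eq, Ideal.dvd_iff_le, span_singleton_le_iff_mem]
  exact hv

end Finite

section Record

variable (K : Type*) [Field K] [NumberField K] [IsCMField K]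
variable (v : HeightOneSpectrum (𝓞 (maximalRealSubfield K)))
variable {r : ℕ} (l : Fin r → 𝓞 K) (k : Type*) [Field k]
  (hl : Submodule.span (𝓞 (maximalRealSubfield K)) (Set.range l) = ⊤)

include hl in
/-- **COMMUTATIVE AT EVERY PLACE `v` OF `K⁺` NOT CONTAINING `disc K`**, for every hermitian `H` with unit determinant
good above `v` (file 313's commutativity at a place under a prime prime to `𝔇_{K/K⁺}`). -/
theorem recordCommutative_of_discr_notMem (hv : ((discr K : ℤ) : 𝓞 (maximalRealSubfield K)) ∉ v.asIdeal)
    {H : Matrix (Fin 3) (Fin 3) K} (hH : H.IsHermitian) (hdet : IsUnit H.det)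
    (hbad : ∀ w : HeightOneSpectrum (𝓞 K), w.asIdeal.LiesOver v.asIdeal → w ∉ badSet H) :
    RecordCommutative K v l k H := by
  obtain ⟨P, hP, hPv⟩ := (Ideal.nonempty_primesOver (S := 𝓞 K) v.asIdeal).some
  haveI := hP
  haveI := hPv
  let w : HeightOneSpectrum (𝓞 K) := ⟨P, hP, Ideal.ne_bot_of_liesOver_of_ne_bot v.ne_bot P⟩
  haveI : w.asIdeal.LiesOver v.asIdeal := hPv
  exact recordCommutative_of_not_dvd_differentIdeal K v l k w (not_dvd_differentIdeal_of_discr_notMem K v w hv)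
    hl hH hdet (hbad w hPv)

/-- **A place `v` of `K⁺` not containing `disc K` with one prime above it stays prime in `K`** (the prime above it is
unramified over `K⁺` and unique, file 236). -/
theorem map_eq_of_discr_notMem_of_ncard_eq_one (hv : ((discr K : ℤ) : 𝓞 (maximalRealSubfield K)) ∉ v.asIdeal)
    (h1 : (v.asIdeal.primesOver (𝓞 K)).ncard = 1) :
    ∃ w : HeightOneSpectrum (𝓞 K),
      Ideal.map (algebraMap (𝓞 (maximalRealSubfield K)) (𝓞 K)) v.asIdeal = w.asIdeal := by
  obtain ⟨P, hP, hPv⟩ := (Ideal.nonempty_primesOver (S := 𝓞 K) v.asIdeal).some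
  haveI := hP
  haveI := hPv
  let w : HeightOneSpectrum (𝓞 K) := ⟨P, hP, Ideal.ne_bot_of_liesOver_of_ne_bot v.ne_bot P⟩
  haveI : w.asIdeal.LiesOver v.asIdeal := hPv
  refine ⟨w, map_eq_of_ramificationIdx'_eq_one_of_ncard_primesOver_eq_one K v w ?_ h1⟩
  exact ramificationIdx'_eq_one_of_liesOver_of_not_dvd_differentIdeal K v w
    (not_dvd_differentIdeal_of_discr_notMem K v w hv)

include hl in
/-- **`k[X]` at every such place with one prime above it.** -/
theorem recordPolynomial_of_discr_notMem (hv : ((discr K : ℤ) : 𝓞 (maximalRealSubfield K)) ∉ v.asIdeal)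
    (h1 : (v.asIdeal.primesOver (𝓞 K)).ncard = 1)
    {H : Matrix (Fin 3) (Fin 3) K} (hH : H.IsHermitian) (hdet : IsUnit H.det)
    (hbad : ∀ w : HeightOneSpectrum (𝓞 K), w.asIdeal.LiesOver v.asIdeal → w ∉ badSet H) :
    RecordPolynomial K v l k H := by
  obtain ⟨P, hP, hPv⟩ := (Ideal.nonempty_primesOver (S := 𝓞 K) v.asIdeal).some
  haveI := hP
  haveI := hPv
  let w : HeightOneSpectrum (𝓞 K) := ⟨P, hP, Ideal.ne_bot_of_liesOver_of_ne_bot v.ne_bot P⟩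
  haveI : w.asIdeal.LiesOver v.asIdeal := hPv
  exact recordPolynomial_of_not_dvd_differentIdeal K v l k w (not_dvd_differentIdeal_of_discr_notMem K v w hv) h1
    hl hH hdet (hbad w hPv)

variable (p : ℕ) [hp : Fact p.Prime] [hvp : v.asIdeal.LiesOver (span {(p : ℤ)})]

include hvp hl in
/-- **THE SATAKE CHAIN WITH NUMERALS AT EVERY NON-SPLIT PLACE NOT CONTAINING `disc K`, FOR EVERY CM FIELD**:
`ChainNumerals K v l k H q (q³ + 1) q⁴ (q⁴ + q)` with `q = p^{f(v/p)}` (file 291's `chainNumerals_of_map_eq`). -/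
theorem chainNumerals_of_discr_notMem [CharZero k]
    (hv : ((discr K : ℤ) : 𝓞 (maximalRealSubfield K)) ∉ v.asIdeal)
    (h1 : (v.asIdeal.primesOver (𝓞 K)).ncard = 1)
    {H : Matrix (Fin 3) (Fin 3) K} (hH : H.IsHermitian) (hdet : IsUnit H.det)
    (hbad : ∀ w : HeightOneSpectrum (𝓞 K), w.asIdeal.LiesOver v.asIdeal → w ∉ badSet H) :
    ChainNumerals K v l k H (p ^ v.asIdeal.inertiaDeg ℤ) ((p ^ v.asIdeal.inertiaDeg ℤ) ^ 3 + 1)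
      ((p ^ v.asIdeal.inertiaDeg ℤ) ^ 4) ((p ^ v.asIdeal.inertiaDeg ℤ) ^ 4 + p ^ v.asIdeal.inertiaDeg ℤ) := by
  obtain ⟨w, hmap⟩ := map_eq_of_discr_notMem_of_ncard_eq_one K v hv h1
  exact chainNumerals_of_map_eq K v p w hmap l k hl hH hdet
    (hbad w (T5CyclotomicSevenHeckeCommutative.liesOver_of_map_eq K v w hmap)) _ _ _ _ rfl rfl rfl rfl

end Record

section Consumer

variable (K : Type*) [Field K] [NumberField K] [IsCMField K]
variable {r : ℕ} (l : Fin r → 𝓞 K) (k : Type*) [Field k] [CharZero k]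
  (hl : Submodule.span (𝓞 (maximalRealSubfield K)) (Set.range l) = ⊤)
variable (M : Matrix (Fin 3) (Fin 3) (𝓞 K)) (hM : IsUnit M.det)
  (hH : ((algebraMap (𝓞 K) K).mapMatrix M).IsHermitian)

include hl hM hH in
/-- **THE RECORD'S LOCAL DATA OUTSIDE THE ABSOLUTE DISCRIMINANT, FOR EVERY CM FIELD — NO DATUM**: for every CM field
`K`, every generator family `l`, every field `k` of characteristic `0` and every integral unimodular hermitian
`H = M.map ι`: (i) the places of `K⁺` containing `disc K` are finitely many; (ii) at every other place `v`:
`e(v/p) = 1` (the kernel half of clause (u2)); every prime `w` of `K` above `v` is prime to `𝔇_{K/K⁺}` and to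
`𝔇_{K/ℚ}` with `e(w/p) = 1`; `H(U(1 ⊗ H), K_v)` is commutative; and if one prime of `K` lies above `v`, lying
over the rational prime `p`, the algebra is `k[X]` and the Satake chain holds with numerals `q = p^{f(v/p)}`. -/
theorem record_hecke_outside_discriminant :
    {v : HeightOneSpectrum (𝓞 (maximalRealSubfield K)) |
      ((discr K : ℤ) : 𝓞 (maximalRealSubfield K)) ∈ v.asIdeal}.Finite ∧
    ∀ v : HeightOneSpectrum (𝓞 (maximalRealSubfield K)),
      ((discr K : ℤ) : 𝓞 (maximalRealSubfield K)) ∉ v.asIdeal →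
        v.asIdeal.ramificationIdx ℤ = 1 ∧
        (∀ w : HeightOneSpectrum (𝓞 K), w.asIdeal.LiesOver v.asIdeal →
          ¬ w.asIdeal ∣ differentIdeal (𝓞 (maximalRealSubfield K)) (𝓞 K) ∧
          ¬ w.asIdeal ∣ differentIdeal ℤ (𝓞 K) ∧ w.asIdeal.ramificationIdx ℤ = 1) ∧
        RecordCommutative K v l k ((algebraMap (𝓞 K) K).mapMatrix M) ∧
        ((v.asIdeal.primesOver (𝓞 K)).ncard = 1 →
          RecordPolynomial K v l k ((algebraMap (𝓞 K) K).mapMatrix M) ∧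
          ∀ (p : ℕ) [Fact p.Prime] [v.asIdeal.LiesOver (span {(p : ℤ)})],
            ChainNumerals K v l k ((algebraMap (𝓞 K) K).mapMatrix M) (p ^ v.asIdeal.inertiaDeg ℤ)
              ((p ^ v.asIdeal.inertiaDeg ℤ) ^ 3 + 1) ((p ^ v.asIdeal.inertiaDeg ℤ) ^ 4)
              ((p ^ v.asIdeal.inertiaDeg ℤ) ^ 4 + p ^ v.asIdeal.inertiaDeg ℤ)) := by
  refine ⟨finite_setOf_intCast_mem (maximalRealSubfield K) _ (by exact_mod_cast discr_ne_zero K),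
    fun v hv => ⟨ramificationIdx_int_eq_one_plus_of_discr_notMem K v hv, fun w hw => ?_, ?_,
      fun h1 => ⟨?_, fun p _ _ => ?_⟩⟩⟩
  · haveI := hw
    exact ⟨not_dvd_differentIdeal_of_discr_notMem K v w hv, not_dvd_differentIdeal_int_of_discr_notMem' K v w hv,
      ramificationIdx_int_eq_one_of_discr_notMem' K v w hv⟩
  · exact recordCommutative_of_discr_notMem K v l k hl hv hH (isUnit_det_mapMatrix M hM)
      (forall_notMem_badSet_mapMatrix v M hM)
  · exact recordPolynomial_of_discr_notMem K v l k hl hv h1 hH (isUnit_det_mapMatrix M hM)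
      (forall_notMem_badSet_mapMatrix v M hM)
  · exact chainNumerals_of_discr_notMem K v l k hl p hv h1 hH (isUnit_det_mapMatrix M hM)
      (forall_notMem_badSet_mapMatrix v M hM)

include hl hM hH in
/-- **THE SAME ABOVE EVERY RATIONAL PRIME `p ∤ disc K`** (MVW's form, `2θ` replaced by the discriminant). -/
theorem record_hecke_outside_discriminant_prime (p : ℕ) (hp : ¬ (p : ℤ) ∣ discr K)
    (v : HeightOneSpectrum (𝓞 (maximalRealSubfield K))) [hvp : v.asIdeal.LiesOver (span {(p : ℤ)})] :
    v.asIdeal.ramificationIdx ℤ = 1 ∧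
    (∀ w : HeightOneSpectrum (𝓞 K), w.asIdeal.LiesOver v.asIdeal →
      ¬ w.asIdeal ∣ differentIdeal (𝓞 (maximalRealSubfield K)) (𝓞 K) ∧
      ¬ w.asIdeal ∣ differentIdeal ℤ (𝓞 K) ∧ w.asIdeal.ramificationIdx ℤ = 1) ∧
    RecordCommutative K v l k ((algebraMap (𝓞 K) K).mapMatrix M) ∧
    ((v.asIdeal.primesOver (𝓞 K)).ncard = 1 →
      RecordPolynomial K v l k ((algebraMap (𝓞 K) K).mapMatrix M) ∧
      ∀ [Fact p.Prime],
        ChainNumerals K v l k ((algebraMap (𝓞 K) K).mapMatrix M) (p ^ v.asIdeal.inertiaDeg ℤ)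
          ((p ^ v.asIdeal.inertiaDeg ℤ) ^ 3 + 1) ((p ^ v.asIdeal.inertiaDeg ℤ) ^ 4)
          ((p ^ v.asIdeal.inertiaDeg ℤ) ^ 4 + p ^ v.asIdeal.inertiaDeg ℤ)) := by
  have hv : ((discr K : ℤ) : 𝓞 (maximalRealSubfield K)) ∉ v.asIdeal := by
    intro hmem
    have hunder : (discr K : ℤ) ∈ v.asIdeal.under ℤ := by
      rw [Ideal.under, Ideal.mem_comap, algebraMap_int_eq, eq_intCast]
      exact hmem
    rw [← hvp.over] at hunder
    exact hp (Ideal.mem_span_singleton.mp hunder)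
  obtain ⟨h1, h2, h3, h4⟩ := (record_hecke_outside_discriminant K l k hl M hM hH).2 v hv
  exact ⟨h1, h2, h3, fun hone => ⟨(h4 hone).1, (h4 hone).2 p⟩⟩

end Consumer

end Summit.Ventures.HodgeRepro2.T5RecordSatakeDiscriminant
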